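/-
Copyright (c) 2026 the pub-hodgecm-mathlib formalisation cell (harness21).  Prover seat hodgecm-mathlib-K2Liu-p11 (g2), Track B «K2-LIT»,
#184♮ = hLiu418 = `stmt-HodgeConjecture-24832`; #41 G6-arch (A∞) for general `K_w`-type, piece (H4-gen) (LEAD F0P6-plan (g14) OWNER WORD σ20: the MEROMORPHIC
PACKAGE byte (iii); K2E5-plan (g7) 14:12:46Z letters (c1)–(c3)).  THEOREMS ONLY (no `def`, no `instance`, no notation, no named-fact hypothesis, no `sorry`).
-/
import Summits.HodgeConjecture.HodgeConjecture.Theorems.K2LiuLadderIntertwinerScalars   -- ★∕📤 (H1) (this seat)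
import Mathlib.Topology.MetricSpace.Pseudo.Defs
import HarnessLib

/-!
# Crux `HLiu418`, G6-arch (A∞), (H4-gen): THE CONTINUATION PACKAGE `(P, G)` OF A LADDER SCALAR — `G = ∏_{p∈P}(s − p) · c(s)` holomorphic on `U`

Cell `hodgecm-mathlib`, crux item hLiu418 = `stmt-HodgeConjecture-24832` (helper lane `--supports`, count-neutral).

From ★ (H1) `scalar_path`: on the convergence region the end scalar of a ladder is `c_n = c₀ · ∏_{i<n} b_i ∕ a_i`.  With AFFINE source scalars `a_i(s) = α_i (s − p_i)`
(★ S2-T shapes `p(s) − l`, `p(s) − k − l − 1`, …; the slopes `α_i` need not even be nonzero for the algebra) and an ANCHOR PACKAGE `(P₀, G₀)` (`G₀ = ∏_{q∈P₀}(s − q) · c₀` holomorphic on `U` — the scalar class, ★ (A)∕(L2)),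
the end scalar has the package `P := P₀ ∪ {p_i}`, `G := G₀ · ∏ b_i ∕ α_i`:
* **`exists_package_of_path`** — `∃ G`, holomorphic on `U`, with `G = (∏_{q∈P₀}(s−q)) · (∏_{i<n}(s − p_i)) · c_n(s)` on the convergence region (arrow-indexed prefix,
  repetitions allowed);
* **`prod_union_image_eq`** ∕ **`exists_package_of_path_finset`** — the sheet's `Finset` currency `∏ p ∈ P, (s - p)` with `P := P₀ ∪ image p (range n)` when the dead
  abscissae are DISTINCT and disjoint from `P₀` (a repeated abscissa would need a squared prefix — then deliver the arrow-indexed form and let the consumer's package algebra decide);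
* **`exists_local_bound_of_differentiableOn`** ∕ `exists_local_bound_re_pos` — the growth letter in the sheet's LOCAL shape (c1): holomorphic on an open `U` ⇒ `∀ z ∈ U, ∃ C r, 0 < r ∧ ∀ s, dist s z < r → s ∈ U → ‖G s‖ ≤ C`.
References: [LeeZhu1998, §5]; [Shimura1997, §16.4]; [KudlaRallis1994 (citation)].
HONEST LABEL: HC_CM is proved only modulo the 7 printed citations (2 remaining named inputs: hLiu418 = stmt-HodgeConjecture-24832,
h413 = stmt-HodgeConjecture-24833) until rung 0 closes; count-neutral helper, closes no socket.
-/

set_option autoImplicit false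
set_option linter.dupNamespace false

namespace Summit.HodgeConjecture.HodgeConjecture.Cruxes.HLiu418.K2LiuLadderContinuationPackage

open Complex Set
open Summit.HodgeConjecture.HodgeConjecture.Cruxes.HLiu418.K2LiuLadderIntertwinerScalars

/-! ## §1  The package of a ladder scalar (arrow-indexed prefix) -/

/-- Cancelling the affine source scalars: `(∏ (z − p_i)) · ∏ b_i ∕ (α_i (z − p_i)) = ∏ b_i ∕ α_i` off the dead abscissae. [folklore] -/
theorem prod_sub_mul_prod_div_affine (n : ℕ) (α p : ℕ → ℂ) (b : ℕ → ℂ → ℂ) (z : ℂ) (hz : ∀ i < n, z ≠ p i) :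
    (∏ i ∈ Finset.range n, (z - p i)) * ∏ i ∈ Finset.range n, (b i z / (α i * (z - p i))) = ∏ i ∈ Finset.range n, (b i z / α i) := by
  rw [← Finset.prod_mul_distrib]
  refine Finset.prod_congr rfl fun i hi => ?_
  have hi' := Finset.mem_range.1 hi
  have hzp : z - p i ≠ 0 := sub_ne_zero.2 (hz i hi')
  field_simp

/-- **THE CONTINUATION PACKAGE OF A LADDER SCALAR.** Arrow-indexed prefix (repetitions allowed). [LeeZhu1998, §5] [Shimura1997, §16.4] -/
theorem exists_package_of_path (U : Set ℂ) (conv : ℂ → Prop) (n : ℕ) (c : ℕ → ℂ → ℂ) (α p : ℕ → ℂ) (b : ℕ → ℂ → ℂ) (P₀ : Finset ℂ) (G₀ : ℂ → ℂ)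
    (hpath : ∀ z, conv z → c n z = c 0 z * ∏ i ∈ Finset.range n, (b i z / (α i * (z - p i))))
    (hlive : ∀ z, conv z → ∀ i < n, z ≠ p i)
    (hG₀ : DifferentiableOn ℂ G₀ U) (hG₀eq : ∀ z, conv z → G₀ z = (∏ q ∈ P₀, (z - q)) * c 0 z)
    (hb : ∀ i < n, DifferentiableOn ℂ (b i) U) :
    ∃ G : ℂ → ℂ, DifferentiableOn ℂ G U ∧
      ∀ z, conv z → G z = (∏ q ∈ P₀, (z - q)) * (∏ i ∈ Finset.range n, (z - p i)) * c n z := by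
  refine ⟨fun z => G₀ z * ∏ i ∈ Finset.range n, (b i z / α i), ?_, fun z hz => ?_⟩
  · exact hG₀.mul (differentiableOn_finset_prod U (Finset.range n) (fun i z => b i z / α i) fun i hi =>
      (hb i (Finset.mem_range.1 hi)).div_const (α i))
  · show G₀ z * ∏ i ∈ Finset.range n, (b i z / α i) = _
    rw [hG₀eq z hz, hpath z hz, ← prod_sub_mul_prod_div_affine n α p b z (hlive z hz)]
    ring

/-! ## §2  The sheet's `Finset` currency -/

/-- Distinct dead abscissae disjoint from the anchor package: `(∏_{q∈P₀}(z−q)) · ∏_{i<n}(z − p_i) = ∏_{q ∈ P₀ ∪ image p (range n)} (z − q)`. [folklore] -/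
theorem prod_union_image_eq (n : ℕ) (p : ℕ → ℂ) (P₀ : Finset ℂ) (hinj : Set.InjOn p (Finset.range n : Set ℕ))
    (hdisj : Disjoint P₀ ((Finset.range n).image p)) (z : ℂ) :
    (∏ q ∈ P₀ ∪ (Finset.range n).image p, (z - q)) = (∏ q ∈ P₀, (z - q)) * ∏ i ∈ Finset.range n, (z - p i) := by
  rw [Finset.prod_union hdisj, Finset.prod_image hinj]

/-- **THE PACKAGE IN `Finset` FORM** (`P := P₀ ∪ image p (range n)`): `∃ G` holomorphic on `U` with `G = (∏ p ∈ P, (s - p)) * c_n s` on the convergence region.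
[LeeZhu1998, §5] [Shimura1997, §16.4] -/
theorem exists_package_of_path_finset (U : Set ℂ) (conv : ℂ → Prop) (n : ℕ) (c : ℕ → ℂ → ℂ) (α p : ℕ → ℂ) (b : ℕ → ℂ → ℂ) (P₀ : Finset ℂ)
    (G₀ : ℂ → ℂ)
    (hpath : ∀ z, conv z → c n z = c 0 z * ∏ i ∈ Finset.range n, (b i z / (α i * (z - p i))))
    (hlive : ∀ z, conv z → ∀ i < n, z ≠ p i)
    (hG₀ : DifferentiableOn ℂ G₀ U) (hG₀eq : ∀ z, conv z → G₀ z = (∏ q ∈ P₀, (z - q)) * c 0 z)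
    (hb : ∀ i < n, DifferentiableOn ℂ (b i) U) (hinj : Set.InjOn p (Finset.range n : Set ℕ)) (hdisj : Disjoint P₀ ((Finset.range n).image p)) :
    ∃ G : ℂ → ℂ, DifferentiableOn ℂ G U ∧ ∀ z, conv z → G z = (∏ q ∈ P₀ ∪ (Finset.range n).image p, (z - q)) * c n z := by
  obtain ⟨G, hG, hGeq⟩ := exists_package_of_path U conv n c α p b P₀ G₀ hpath hlive hG₀ hG₀eq hb
  exact ⟨G, hG, fun z hz => by rw [hGeq z hz, prod_union_image_eq n p P₀ hinj hdisj z]⟩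

/-! ## §3  The growth letter: local boundedness (the sheet's (c1) shape) -/

/-- **HOLOMORPHIC ON AN OPEN SET ⇒ LOCALLY BOUNDED**, in the shape of the #41 sheet's `hgrowth`∕`hmaj` letters (a ball `dist s z < r` around each `z ∈ U`).
[folklore] -/
theorem exists_local_bound_of_differentiableOn {U : Set ℂ} (hU : IsOpen U) {G : ℂ → ℂ} (hG : DifferentiableOn ℂ G U) (z : ℂ) (hz : z ∈ U) :
    ∃ C r : ℝ, 0 < r ∧ ∀ s : ℂ, dist s z < r → ‖G s‖ ≤ C := by
  have hc : ContinuousAt G z := (hG.continuousOn.continuousAt (hU.mem_nhds hz))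
  rcases Metric.continuousAt_iff.1 hc 1 one_pos with ⟨r, hr, h⟩
  refine ⟨‖G z‖ + 1, r, hr, fun s hs => ?_⟩
  have h1 : dist (G s) (G z) < 1 := h hs
  calc ‖G s‖ = ‖G z + (G s - G z)‖ := by rw [add_sub_cancel]
    _ ≤ ‖G z‖ + ‖G s - G z‖ := norm_add_le _ _
    _ ≤ ‖G z‖ + 1 := by
        rw [← dist_eq_norm]
        exact add_le_add_right h1.le _

/-- At the sheet's `U = {0 < re}` (open: ★ `Literature.NumberTheory.LFunctions.isOpen_re_pos`, or `isOpen_lt continuous_const continuous_re` inline): the local bound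
for a package `G` holomorphic on the right half-plane. [folklore] -/
theorem exists_local_bound_re_pos {G : ℂ → ℂ} (hG : DifferentiableOn ℂ G {s : ℂ | 0 < s.re}) (z : ℂ) (hz : 0 < z.re) :
    ∃ C r : ℝ, 0 < r ∧ ∀ s : ℂ, dist s z < r → ‖G s‖ ≤ C :=
  exists_local_bound_of_differentiableOn (isOpen_lt continuous_const Complex.continuous_re) hG z hz

end Summit.HodgeConjecture.HodgeConjecture.Cruxes.HLiu418.K2LiuLadderContinuationPackage
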